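import Literature.MathematicalPhysics.QuantumFieldTheory.Balaban1983to89.B1TorusBoxHolderLetters

/-!
# `Balaban1983to89.B1Ineq224RegularBox` — T. Bałaban, *(Higgs)₂,₃ quantum fields in a finite volume. I*, Commun. Math. Phys. **85**
# (1982) 603–626 [Balaban1982Higgs1], PROP. 2.1 (2.24), THE HÖLDER MEMBER, **WITHOUT THE RESTRICTION dist({x, x′}, Ωᶜ) ≥ R₀** FOR
# BOXES OF LARGE BLOCKS `Ω ⊂ T_ε` on the (Higgs)₂,₃ carrier at every (2.23)-regular `A` — the sentence p. 611 l.1–2 «For some simple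
# sets Ω, e.g. for rectangular parallelepipeds, the inequalities hold without any restrictions on the points x, x′» (= [Balaban1983RegularityDecay]
# p. 579 «if Ω is a rectangular parallelepiped, then all □_j in the representation (2.13) are cubes and we can apply Lemma 2.2 to all
# operators in it, so the restriction dist({x, x′}, Ωᶜ) ≧ R₀ is unnecessary»), carried to the HÖLDER member (2.24) = [B4] Theorem (1.9)

statement-level skeleton of published theorems with citation tags; proofs where landed; nothing here is a claim about the Yang–Mills mass gap

PDF held: `paper:balaban1982-cmp85-higgs23-i` pp. 610–611 [PDF 8–9] (`p0008.txt`, `p0009.txt`, re-read by this seat 2026-08-23);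
`paper:balaban1983-cmp89-regularity-decay` pp. 573, 575–579 [PDF 3, 5–9].

CITATION HEADER (lean-in-tree rule).  Cell `lit-balaban` (HOME `run/shared/lean/pub/lit-balaban/`), Phase-2 proof seat **p35** gen 21 (unit
`lit-balaban-p35`); SKELETON rows **B1.Prop2.1** / **B1.Eq2.24** (the parallelepiped clause of Prop. 2.1 on the concrete carrier, HÖLDER member:
MODEL INSTANCE; the value/derivative members (2.25) are gen 15's `B1Ineq225RegularBox`) and **B4.Thm@573** ((1.9) without `R₀` on boxes,
carrier instance).  USED BY NAME, never restated: gen 15's `B1Ineq225RegularBox.{cellBox, isBigBlockUnion_cellBox, box_letters,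
chain_allgood_of_inputs_probe, norm_RopP_pow_le, exists_norm_GP_le, norm_covDeriv_propagatorK_box_reg_decay}`, this seat's gen-21
`B1TorusBoxHolderLetters.box_letters_holder` (the (1,α)-letter at every label: interior windows by gen 10/12, boundary pieces by the no-collar
Hölder input `B1TorusSubBoxHolderInput.subbox_input_holder` ← `B4Lemma22HolderNoCollarContours`), gen 12's region framework
`B1TorusRegionCubes`/`B1TorusRegionRop`/`B1TorusLabelWalk`, `B1Ineq225DerivRegularRegion.{norm_covDeriv_le, exists_le_of_geometric, covDeriv_add',
covDeriv_zero', covDeriv_sum'}`, `B1Ineq225DerivDecayBackgroundTorus.covDeriv_hsmul_eq_zero_off`, gen 10's `B1TorusChainTransport.{IsTChain, hol,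
norm_hol_apply}`, r14's `tdist_blockIter_le_real`, `sum_exp_neg_tdist_le`, `B1Ineq225RegularRegion.{rS_le_real, blockPiece, sum_blockPiece}`.

WHAT IS PRINTED.  [B1] p. 610 [PDF 8], Prop. 2.1, verbatim (text layer): «Then for e(L^kε) sufficiently small and α < 1 there exist positive
constants δ₀, c₀, R₀ independent of A, k, Ω and depending on d, α, M only, c₀ on a also, such that for an arbitrary function f : Ω → R^N we have
|x − x′|^{−α}|U(A(Γ_{x,x′}))(D^η_{A,μ}G_k(Ω, A)f)(x′) − (D^η_{A,μ}G_k(Ω, A)f)(x)| ≤ c₀ exp(−δ₀ dist({x, x′}, supp f))‖f‖_∞ (2.24) for x, x′ ∈ Ω and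
satisfying the condition dist({x, x′}, Ωᶜ) ≥ R₀.»; p. 611 [PDF 9] l.1–2, verbatim: «For some simple sets Ω, e.g. for rectangular
parallelepipeds, the inequalities hold without any restrictions on the points x, x′, i.e. for all x, x′ ∈ Ω.»  [B4] p. 578 [PDF 8]: «If
|x′ − x| > 1, then this inequality is a simple consequence of the corresponding inequality for the derivative only, hence we can assume
|x′ − x| ≤ 1.»; p. 579 [PDF 9] L25–28, verbatim: «Finally let us notice that if Ω is a rectangular parallelepiped, then all □_j in the
representation (2.13) are cubes and we can apply Lemma 2.2 to all operators in it, so the restriction dist({x, x′}, Ωᶜ) ≧ R₀ is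
unnecessary.»

READING PROVED HERE.  «Rectangular parallelepiped» ↦ gen 15's CELL-PRODUCT set of large blocks `Ω = cellBox S` (`M = L^K·K₀` fine sites);
«for all x, x′ ∈ Ω» for the Hölder member ↦ every pair of bonds `⟨x, x+εe_μ⟩`, `⟨x′, x′+εe_μ⟩` with both ends in `Ω` (the bonds the Neumann
operator of `Ω` has) and a shortest nearest-neighbour contour `Γ_{x,x′} ⊂ Ω` (for a box such a contour stays in the box).

WHAT THIS FILE PROVES (kernel-checked, zero `sorry`; theorems only; no `def … : Prop` fact).
* §1 **`norm_holder_propagatorK_box_reg_decay`** — PROP. 2.1 (2.24), HÖLDER MEMBER, FOR `Ω = cellBox S` AT EVERY (2.23)-REGULAR `A`, EVERY PAIR OF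
  BONDS OF `Ω` (no `R₀`), `g` in a `K`-block: for `d ≥ 1`, `L ≥ 2`, `a, m² > 0`, `N`, `(e, q)`, `ε₀`, `(c, β)`: a cube-size threshold `K₀min`
  chosen BEFORE `α`, and for every `0 ≤ α < 1` a constant `c₀ > 0` and per `K₀ ≥ K₀min` a threshold `e₁ > 0` such that on every torus of the
  carrier (`K₀ ∣ M`), every level `1 ≤ K ≤ K_P` with `3L^KK₀ ≤ |T_ε|_μ`, `L^Kε ≤ ε₀`, every `S`, every `A`, `0 < e_K ≤ e₁` with (2.23) on `Ω`,
  every `μ`, sites `x′ ≠ x` with `x, x+εe_μ, x′, x′+εe_μ ∈ Ω`, nearest-neighbour chain `Γ ⊂ Ω` with `|Γ| ≤ d|x − x′|`, every `g` in a `K`-block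
  with `‖g‖_∞ ≤ M′` vanishing within `D` of `x` and of `x′`:
  `(|x − x′|/L^K)^{−α}·‖U(A(Γ))(D^ε_AG^ε_K(Ω,A)1_Ωg)(⟨x′,μ⟩) − (D^ε_AG^ε_K(Ω,A)1_Ωg)(⟨x,μ⟩)‖ ≤ c₀(L^Kε)·e^{−D/(2K₀L^K)}·M′`.
  Proof: `|x − x′| ≤ L^K` by gen 15's all-labels-good walk `chain_allgood_of_inputs_probe` with the Hölder probe at `X₀ = {x, x′}` (letters
  `box_letters` / `box_letters_holder`, the tail from the sup letters); `|x − x′| > L^K` from gen 15's derivative member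
  `norm_covDeriv_propagatorK_box_reg_decay` at both bonds.
* §2 **`norm_holder_propagatorK_box_reg_decay_sum`** — the same for ARBITRARY `g` (summed over the `K`-blocks), rate `e^{−D/(4K₀L^K)}`, `c₀(K₀)`.
HONEST SCOPE.  (i) `Ω` a cell-product of large blocks (`K₀ ∣ M_P`, `3M ≤ |T_ε|_μ`; also wrapping the torus); general big-block unions with
non-box pieces are gen 12's `B1Ineq224RegularRegion`, under `R₀`; (ii) operator form (not the kernel form); the chain `Γ` is assumed inside
`Ω`; (iii) constants existential but explicit in the proofs, not optimised; (iv) (2.23) used on `Ω` only (`z ∈ Ω`, the neighbour anywhere);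
(v) (2.26) on boxes without `R₀` remains a separate row.  Unit `lit-balaban-p35` gen 21 (literature-prover-lit-balaban-p35-g21-0).
-/

open scoped BigOperators

noncomputable section

namespace Literature.MathematicalPhysics.QuantumFieldTheory.Balaban1983to89.B1Ineq224RegularBox

open Literature.MathematicalPhysics.QuantumFieldTheory.Balaban1983to89.HiggsLattice
open Literature.MathematicalPhysics.QuantumFieldTheory.Balaban1983to89.HiggsAveraging
open Literature.MathematicalPhysics.QuantumFieldTheory.Balaban1983to89.HiggsCovariance
open Literature.MathematicalPhysics.QuantumFieldTheory.Balaban1983to89.B1TorusCubeCover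
open Literature.MathematicalPhysics.QuantumFieldTheory.Balaban1983to89.B1TorusCubeLocality26
open Literature.MathematicalPhysics.QuantumFieldTheory.Balaban1983to89.B1TorusCubeChart
open Literature.MathematicalPhysics.QuantumFieldTheory.Balaban1983to89.B1TorusRegionCubes
open Literature.MathematicalPhysics.QuantumFieldTheory.Balaban1983to89.B1TorusRegionHSizes (IsBigBlockUnion blockSat_of_isBigBlockUnion)
open Literature.MathematicalPhysics.QuantumFieldTheory.Balaban1983to89.B1TorusRegionRop
open Literature.MathematicalPhysics.QuantumFieldTheory.Balaban1983to89.B1TorusLabelWalk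
open Literature.MathematicalPhysics.QuantumFieldTheory.Balaban1983to89.B1TorusChainTransport (IsTChain hol norm_hol_apply)
open Literature.MathematicalPhysics.QuantumFieldTheory.Balaban1983to89.B4GaugeCovariance (pathEnd)
open Literature.MathematicalPhysics.QuantumFieldTheory.Balaban1983to89.B1Ineq225RegularRegion (rS_le_real blockPiece sum_blockPiece
  blockPiece_supported norm_blockPiece_apply_le)
open Literature.MathematicalPhysics.QuantumFieldTheory.Balaban1983to89.B1Ineq225DerivRegularRegion (norm_covDeriv_le exists_le_of_geometric
  covDeriv_zero' covDeriv_add' covDeriv_sum')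
open Literature.MathematicalPhysics.QuantumFieldTheory.Balaban1983to89.B1Ineq225DerivDecayBackgroundTorus (covDeriv_hsmul_eq_zero_off)
open Literature.MathematicalPhysics.QuantumFieldTheory.Balaban1983to89.B1Ineq234LevelZero (tdist_triangle_real tdist_shift_le_one)
open Literature.MathematicalPhysics.QuantumFieldTheory.Balaban1983to89.B1Ineq234Concrete (tdist_blockIter_le_real)
open Literature.MathematicalPhysics.QuantumFieldTheory.Balaban1983to89.B2Eq230CondShiftBound (sum_exp_neg_tdist_le)
open Literature.MathematicalPhysics.QuantumFieldTheory.Balaban1983to89.B4Sect5Proof (latticeConst latticeConst_nonneg)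
open Literature.MathematicalPhysics.QuantumFieldTheory.Balaban1983to89.B1Ineq225RegularBox
open Literature.MathematicalPhysics.QuantumFieldTheory.Balaban1983to89.B1TorusBoxHolderLetters (box_letters_holder)

variable {P : HiggsLattice.Params} {N : ℕ}

/-! ## §1 Prop. 2.1 (2.24), the Hölder member, for boxes of large blocks WITHOUT `R₀`: the two regimes of [B4] p. 578 -/

section Main

variable {K K₀ : ℕ}

/-- distinct torus sites are at (1.3)-distance at least one lattice unit. [cite: Balaban1982Higgs1, (1.3) p.604] -/
private theorem one_le_tdist_of_ne {k : ℕ} {x x' : HiggsLattice.Site P k} (h : x' ≠ x) : 1 ≤ HiggsLattice.Site.tdist x x' := by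
  obtain ⟨μ, hμ⟩ : ∃ μ, x' μ ≠ x μ := by
    by_contra hc
    push Not at hc
    exact h (funext hc)
  unfold HiggsLattice.Site.tdist
  refine le_trans ?_ (Finset.le_sup (f := fun ν : Fin P.d => min (x ν - x' ν).val (x' ν - x ν).val) (Finset.mem_univ μ))
  refine le_min ?_ ?_
  · exact Nat.one_le_iff_ne_zero.2 fun h0 => hμ (sub_eq_zero.1 ((ZMod.val_eq_zero _).1 h0)).symm
  · exact Nat.one_le_iff_ne_zero.2 fun h0 => hμ (sub_eq_zero.1 ((ZMod.val_eq_zero _).1 h0))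

/-- **THE REMAINDER OF (2.12) UNDER THE DERIVATIVE AT ONE BOND, FROM THE SUP LETTERS** (gen 15's `exists_deriv_tail_le'`, the explicit geometric
bound): `‖D^ε_A((G1_Ω)(R1_Ω)^m g)(b)‖ ≤ (2^dβ)^m·ε⁻¹·2C‖g‖_∞`. [cite: Balaban1983RegularityDecay, (2.12) p.577] -/
private theorem norm_covDeriv_GPRop_le (C : ChargeData N) (Ω : Finset (HiggsLattice.Site P 0)) (A : HiggsLattice.VecField P 0) {msq a : ℝ}
    (hK : K ≤ P.K) (hK₀ : K₀ ∣ P.M) (hK₀8 : 8 ≤ K₀) {β : ℝ} (hβ : 0 ≤ β)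
    (h0 : ∀ (j : Lab P K K₀) (ψ : HiggsLattice.ScalarField P 0 N), (∀ y, y ∉ Ω → ψ y = 0) →
      ‖bOp C K K₀ Ω A msq a j ψ‖ ≤ β * ‖ψ‖)
    {Cst : ℝ} (hC : 0 ≤ Cst) (hGP : ∀ v : HiggsLattice.ScalarField P 0 N, ‖GP C K Ω A msq a v‖ ≤ Cst * ‖v‖)
    (g : HiggsLattice.ScalarField P 0 N) (b : HiggsLattice.PBond P 0) (m : ℕ) :
    ‖covDeriv C A ((GP C K Ω A msq a * RopP C K K₀ Ω A msq a ^ m) g) b‖ ≤ (2 ^ P.d * β) ^ m * ((P.mesh 0)⁻¹ * (2 * (Cst * ‖g‖))) := by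
  have hm := P.mesh_pos 0
  have hw : ‖(GP C K Ω A msq a * RopP C K K₀ Ω A msq a ^ m) g‖ ≤ (2 ^ P.d * β) ^ m * (Cst * ‖g‖) := by
    rw [Module.End.mul_apply]
    calc ‖GP C K Ω A msq a ((RopP C K K₀ Ω A msq a ^ m) g)‖ ≤ Cst * ‖(RopP C K K₀ Ω A msq a ^ m) g‖ := hGP _
      _ ≤ Cst * ((2 ^ P.d * β) ^ m * ‖g‖) := mul_le_mul_of_nonneg_left (norm_RopP_pow_le C Ω A hK hK₀ hK₀8 hβ h0 m g) hC
      _ = (2 ^ P.d * β) ^ m * (Cst * ‖g‖) := by ring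
  refine (norm_covDeriv_le C A _ b).trans ?_
  have ht := (norm_le_pi_norm ((GP C K Ω A msq a * RopP C K K₀ Ω A msq a ^ m) g) b.tgt).trans hw
  have hs := (norm_le_pi_norm ((GP C K Ω A msq a * RopP C K K₀ Ω A msq a ^ m) g) b.src).trans hw
  calc (P.mesh 0)⁻¹ * (‖(GP C K Ω A msq a * RopP C K K₀ Ω A msq a ^ m) g b.tgt‖
        + ‖(GP C K Ω A msq a * RopP C K K₀ Ω A msq a ^ m) g b.src‖)
      ≤ (P.mesh 0)⁻¹ * (2 * ((2 ^ P.d * β) ^ m * (Cst * ‖g‖))) := mul_le_mul_of_nonneg_left (by linarith) (inv_nonneg.2 hm.le)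
    _ = (2 ^ P.d * β) ^ m * ((P.mesh 0)⁻¹ * (2 * (Cst * ‖g‖))) := by ring

set_option maxHeartbeats 1600000 in
/-- **PROP. 2.1 (2.24), THE HÖLDER MEMBER WITH ITS DECAY FACTOR, FOR BOXES OF LARGE BLOCKS `Ω ⊂ T_ε` WITHOUT THE RESTRICTION
`dist({x, x′}, Ωᶜ) ≥ R₀`, AT EVERY (2.23)-REGULAR VECTOR FIELD — B4's THEOREM (1.9) ON THE CARRIER FOR PARALLELEPIPEDS** («For some simple sets
Ω, e.g. for rectangular parallelepipeds, the inequalities hold without any restrictions on the points x, x′»), `g` supported in a `K`-block.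
For `d ≥ 1`, `L ≥ 2`, `a > 0`, `m² > 0`, `N`, `(e, q)`, a mesh cap `ε₀` and a regularity pair `c ≥ 0`, `β > 0`: a cube-size threshold `K₀min`
chosen BEFORE `α`, and for every `0 ≤ α < 1` a constant `c₀ > 0` and per cube size `K₀ ≥ K₀min` a threshold `e₁ > 0` such that on EVERY
torus of the carrier with `K₀ ∣ M`, at every level `1 ≤ K ≤ K_P` with `3·L^KK₀ ≤ |T_ε|_μ`, `L^Kε ≤ ε₀`, for EVERY cell-product box `Ω = cellBox S`,
EVERY vector field `A` and `0 < e_K ≤ e₁` with (2.23) on `Ω`, every direction `μ`, sites `x′ ≠ x` WITH `x, x + εe_μ, x′, x′ + εe_μ ∈ Ω` (no `R₀`)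
and a nearest-neighbour chain `Γ ⊂ Ω` from `x` to `x′` with `|Γ| ≤ d|x − x′|`, every `g` supported in a `K`-block with `‖g‖_∞ ≤ M′` vanishing
at the sites within distance `< D` of `x` and of `x′`:
`(|x − x′|/L^K)^{−α}·‖U(A(Γ))(D^ε_AG^ε_K(Ω, A)1_Ωg)(⟨x′,μ⟩) − (D^ε_AG^ε_K(Ω, A)1_Ωg)(⟨x,μ⟩)‖ ≤ c₀(L^Kε)·exp(−D/(2K₀L^K))·M′`.
Proof: `|x − x′| ≤ L^K` by `chain_allgood_of_inputs_probe` with the Hölder probe at `X₀ = {x, x′}` (letters `box_letters`, the (1,α)-letter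
`box_letters_holder`, room `K₀ ≥ 8d + 24`, `3^d·C_m/K₀ ≤ e^{−1}`); `|x − x′| > L^K` from `norm_covDeriv_propagatorK_box_reg_decay` at both bonds.
[cite: Balaban1982Higgs1, Prop. 2.1 (2.23)–(2.24) p.610, p.611 l.1–2] [cite: Balaban1983RegularityDecay, Theorem (1.9) p.573; p.578; (2.18)–(2.22) pp.578–579; p.579 L25–28] -/
theorem norm_holder_propagatorK_box_reg_decay (d L : ℕ) (hd : 1 ≤ d) (hL : 2 ≤ L) {a : ℝ} (ha : 0 < a) {msq : ℝ} (hmsq : 0 < msq)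
    (N : ℕ) (C : ChargeData N) (ε₀ : ℝ) (creg β : ℝ) (hcreg : 0 ≤ creg) (hβ : 0 < β) :
    ∃ K₀min : ℕ, ∀ {α : ℝ}, 0 ≤ α → α < 1 → ∃ c₀ : ℝ, 0 < c₀ ∧ ∀ K₀ : ℕ, K₀min ≤ K₀ → ∃ e₁ : ℝ, 0 < e₁ ∧
      ∀ (P : HiggsLattice.Params), P.d = d → P.L = L → K₀ ∣ P.M →
      ∀ {K : ℕ}, 1 ≤ K → K ≤ P.K → (∀ μ, 3 * half P K K₀ ≤ P.sitesPerDir 0 μ) → P.mesh K ≤ ε₀ →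
      ∀ (S : Fin P.d → Finset ℕ) (A : HiggsLattice.VecField P 0) {ec : ℝ}, 0 < ec → ec ≤ e₁ →
      (∀ z ∈ cellBox K K₀ S, ∀ μ ν : Fin P.d,
          P.mesh K * |C.e| / ec * |A ⟨z.shift μ, ν⟩ - A ⟨z, ν⟩| ≤ creg * ec ^ (β - 1) / (P.L : ℝ) ^ K) →
      ∀ (μ : Fin P.d) (x x' : HiggsLattice.Site P 0), x' ≠ x →
        x ∈ cellBox K K₀ S → x.shift μ ∈ cellBox K K₀ S → x' ∈ cellBox K K₀ S → x'.shift μ ∈ cellBox K K₀ S →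
        ∀ (l : List (HiggsLattice.Site P 0)), IsTChain x l → pathEnd x l = x' → (∀ y ∈ l, y ∈ cellBox K K₀ S) →
          (l.length : ℝ) ≤ (P.d : ℝ) * HiggsLattice.Site.tdist x x' →
        ∀ (y₀ : HiggsLattice.Site P 0) (g : HiggsLattice.ScalarField P 0 N) (M D : ℝ),
          (∀ y, blockIter K y ≠ blockIter K y₀ → g y = 0) → (∀ y, ‖g y‖ ≤ M) → 0 ≤ D →
          (∀ z, g z ≠ 0 → D ≤ (HiggsLattice.Site.tdist x z : ℝ)) → (∀ z, g z ≠ 0 → D ≤ (HiggsLattice.Site.tdist x' z : ℝ)) →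
            (((HiggsLattice.Site.tdist x x' : ℝ) / (P.L : ℝ) ^ K)⁻¹) ^ α *
                ‖hol C A x l (covDeriv C A (propagatorK C (cellBox K K₀ S) A msq a K (chi (cellBox K K₀ S) • g)) ⟨x', μ⟩)
                  - covDeriv C A (propagatorK C (cellBox K K₀ S) A msq a K (chi (cellBox K K₀ S) • g)) ⟨x, μ⟩‖
              ≤ c₀ * P.mesh K * Real.exp (-(D / (2 * K₀ * (P.L : ℝ) ^ K))) * M := by
  have hℓ0 : 1 ≤ L - 1 := by omega
  obtain ⟨Cg, Cm, hCg, hCm, hL0⟩ := box_letters C (d - 1) (L - 1) hℓ0 ha hmsq (msq * ε₀ ^ 2) creg β hcreg hβ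
  obtain ⟨c₉, hc₉, K₉, hfar⟩ := norm_covDeriv_propagatorK_box_reg_decay d L hd hL ha hmsq N C ε₀ creg β hcreg hβ
  -- the cube size is fixed BEFORE `α`
  refine ⟨max (max K₉ 8) (max ⌈(3 : ℝ) ^ d * Cm * Real.exp 1⌉₊ (8 * d + 24)), fun {α} hα0 hα1 => ?_⟩
  obtain ⟨CT, hCT, hhol⟩ := box_letters_holder C (d - 1) (L - 1) hℓ0 ha hmsq (msq * ε₀ ^ 2) creg β hcreg hβ hα0 hα1
  refine ⟨4 * 2 ^ d * CT * Real.exp (3 / 2) + 2 * c₉, by positivity, fun K₀ hK₀ => ?_⟩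
  have hK₀9 : K₉ ≤ K₀ := le_trans (le_trans (le_max_left _ _) (le_max_left _ _)) hK₀
  have hK₀8 : 8 ≤ K₀ := le_trans (le_trans (le_max_right _ _) (le_max_left _ _)) hK₀
  have hK₀r : (0 : ℝ) < K₀ := by exact_mod_cast lt_of_lt_of_le (by norm_num) hK₀8
  have hK₀C : (3 : ℝ) ^ d * Cm * Real.exp 1 ≤ K₀ :=
    (Nat.le_ceil _).trans (by exact_mod_cast le_trans (le_trans (le_max_left _ _) (le_max_right _ _)) hK₀)
  have hK₀d : 8 * d + 24 ≤ K₀ := le_trans (le_trans (le_max_right _ _) (le_max_right _ _)) hK₀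
  have hK₀d' : 8 * (d - 1 + 1) + 24 ≤ K₀ := by rwa [Nat.sub_add_cancel hd]
  obtain ⟨e₁, he₁, hLK⟩ := hL0 K₀ hK₀8
  obtain ⟨e₄, he₄, hholK⟩ := hhol K₀ hK₀d'
  obtain ⟨e₉, he₉, hfarK⟩ := hfar K₀ hK₀9
  refine ⟨min e₁ (min e₄ e₉), lt_min he₁ (lt_min he₄ he₉), ?_⟩
  intro P hPd hPL hK₀M K hK1 hK hN3 hε S A ec hec hle' hreg μ x x' hne hxΩ hsΩ hx'Ω hs'Ω l hch hend hlc hlen y₀ g M D hg hgM hD0 hDx hDx'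
  have hle1 : ec ≤ e₁ := hle'.trans (min_le_left _ _)
  have hle4 : ec ≤ e₄ := hle'.trans ((min_le_right _ _).trans (min_le_left _ _))
  have hle9 : ec ≤ e₉ := hle'.trans ((min_le_right _ _).trans (min_le_right _ _))
  -- the far-regime tool: the derivative member at a bond of `Ω` with the distance `D`
  have hfar' := fun (z : HiggsLattice.Site P 0) (hz : z ∈ cellBox K K₀ S) (hzs : z.shift μ ∈ cellBox K K₀ S)
      (hDz : ∀ w, g w ≠ 0 → D ≤ (HiggsLattice.Site.tdist z w : ℝ)) =>
    hfarK P hPd hPL hK₀M hK1 hK hN3 hε S A hec hle9 hreg z μ hz hzs y₀ g M D hg hgM hD0 hDz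
  subst hPd
  set Ω : Finset (HiggsLattice.Site P 0) := cellBox K K₀ S with hΩdef
  have hdd : dd P = P.d - 1 := rfl
  have hPL1 : P.L - 1 = L - 1 := by rw [hPL]
  have hL1 : 1 < P.L := by rw [hPL]; omega
  have hL1r : (1 : ℝ) < P.L := by exact_mod_cast hL1
  have hak : 0 ≤ B1.aSeq a P.L K := (B1.aSeq_pos ha hL1r hK1).le
  have hK₀' : 1 ≤ K₀ := le_trans (by norm_num) hK₀8
  have hmesh : 0 < P.mesh K := P.mesh_pos K
  have hmesh0 : 0 < P.mesh 0 := P.mesh_pos 0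
  have hcap : msq * P.mesh K ^ 2 ≤ msq * ε₀ ^ 2 := mul_le_mul_of_nonneg_left (pow_le_pow_left₀ hmesh.le hε 2) hmsq.le
  have hM0 : 0 ≤ M := (norm_nonneg _).trans (hgM x)
  have hgn : ‖g‖ ≤ M := (pi_norm_le_iff_of_nonneg hM0).2 hgM
  have hn0 : (0 : ℝ) < (P.L : ℝ) ^ K := pow_pos (by exact_mod_cast P.hL) K
  set t : ℝ := (HiggsLattice.Site.tdist x x' : ℝ) with ht_def
  have ht1 : 1 ≤ t := by rw [ht_def]; exact_mod_cast one_le_tdist_of_ne hne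
  have ht0 : 0 < t := lt_of_lt_of_le one_pos ht1
  have hq0 : 0 < t / (P.L : ℝ) ^ K := div_pos ht0 hn0
  set Q : ℝ := ‖hol C A x l (covDeriv C A (propagatorK C Ω A msq a K (chi Ω • g)) ⟨x', μ⟩)
    - covDeriv C A (propagatorK C Ω A msq a K (chi Ω • g)) ⟨x, μ⟩‖ with hQ_def
  have hQ0 : 0 ≤ Q := norm_nonneg _
  have hE0 := (Real.exp_pos (-(D / (2 * K₀ * (P.L : ℝ) ^ K)))).le
  by_cases hnt : HiggsLattice.Site.tdist x x' ≤ P.L ^ K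
  · -- the regime `|x − x′| ≤ L^K`: the walk for the Hölder probe, all labels good
    have hletters := hLK P hdd hPL1 hK1 hK hK₀M hN3 hcap S A hec hle1 hreg
    -- the letter constant and its smallness
    have hβK0 : 0 ≤ Cm / K₀ := div_nonneg hCm.le hK₀r.le
    have hDβ : (3 : ℝ) ^ P.d * (Cm / K₀) ≤ Real.exp (-1) := by
      rw [mul_div_assoc', div_le_iff₀ hK₀r]
      have h1 : Real.exp (-1) * Real.exp 1 = 1 := by rw [← Real.exp_add]; norm_num
      have h2 : (3 : ℝ) ^ P.d * Cm = (3 : ℝ) ^ P.d * Cm * Real.exp 1 * Real.exp (-1) := by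
        rw [mul_assoc ((3 : ℝ) ^ P.d * Cm), mul_comm (Real.exp 1), h1, mul_one]
      rw [h2]
      exact mul_le_mul_of_nonneg_right hK₀C (Real.exp_pos _).le |>.trans_eq (mul_comm _ _)
    have hsmall : 2 ^ P.d * (Cm / K₀) < 1 := by
      have h3 : (2 : ℝ) ^ P.d ≤ 3 ^ P.d := pow_le_pow_left₀ (by norm_num) (by norm_num) _
      have he : Real.exp (-1) < 1 := Real.exp_lt_one_iff.mpr (by norm_num)
      nlinarith [mul_le_mul_of_nonneg_right h3 hβK0]
    have hγ0 : 0 ≤ CT * (t / (P.L : ℝ) ^ K) ^ α * P.mesh K := by positivity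
    -- `g` vanishes within `⌈D⌉` of both points
    have hfX : ∀ x'' ∈ ({x, x'} : Finset (HiggsLattice.Site P 0)), ∀ y, g y ≠ 0 → ⌈D⌉₊ ≤ HiggsLattice.Site.tdist x'' y := by
      intro x'' hx'' y hy
      simp only [Finset.mem_insert, Finset.mem_singleton] at hx''
      rcases hx'' with h | h
      · subst h; exact Nat.ceil_le.2 (hDx y hy)
      · subst h; exact Nat.ceil_le.2 (hDx' y hy)
    have esub : ∀ a' b' c' d' : EuclideanSpace ℝ (Fin N), a' + b' - (c' + d') = (a' - c') + (b' - d') := fun _ _ _ _ => by abel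
    -- the remainder for the Hölder probe (sup letters only)
    obtain ⟨Cst, hC, hGP⟩ := exists_norm_GP_le C Ω A (K := K) (msq := msq) (a := a)
    have hrem : ∀ ε' : ℝ, 0 < ε' → ∃ m : ℕ,
        ‖hol C A x l (covDeriv C A ((GP C K Ω A msq a * RopP C K K₀ Ω A msq a ^ m) g) ⟨x', μ⟩)
          - covDeriv C A ((GP C K Ω A msq a * RopP C K K₀ Ω A msq a ^ m) g) ⟨x, μ⟩‖ ≤ ε' :=
      exists_le_of_geometric (Φ := fun m => ‖hol C A x l (covDeriv C A ((GP C K Ω A msq a * RopP C K K₀ Ω A msq a ^ m) g) ⟨x', μ⟩)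
          - covDeriv C A ((GP C K Ω A msq a * RopP C K K₀ Ω A msq a ^ m) g) ⟨x, μ⟩‖)
        (by positivity) hsmall (show 0 ≤ 2 * ((P.mesh 0)⁻¹ * (2 * (Cst * ‖g‖))) by positivity) fun m => by
          refine (norm_sub_le _ _).trans ?_
          rw [norm_hol_apply]
          have h1 := norm_covDeriv_GPRop_le C Ω A hK hK₀M hK₀8 hβK0 (fun j ψ hψ => (hletters j ψ hψ).2.2) hC hGP g ⟨x', μ⟩ m
          have h2 := norm_covDeriv_GPRop_le C Ω A hK hK₀M hK₀8 hβK0 (fun j ψ hψ => (hletters j ψ hψ).2.2) hC hGP g ⟨x, μ⟩ m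
          linarith
    -- the chain with the Hölder probe
    have hmain := chain_allgood_of_inputs_probe C Ω A hK hK₀M hK₀8 hN3 (isBigBlockUnion_cellBox S) hmsq hak
      (γ := CT * (t / (P.L : ℝ) ^ K) ^ α * P.mesh K) (β := Cm / K₀) hγ0 hβK0 hDβ
      (Φ := fun w => ‖hol C A x l (covDeriv C A w ⟨x', μ⟩) - covDeriv C A w ⟨x, μ⟩‖)
      (by rw [covDeriv_zero', covDeriv_zero', map_zero, sub_zero, norm_zero])
      (fun u v => by
        show ‖hol C A x l (covDeriv C A (u + v) ⟨x', μ⟩) - covDeriv C A (u + v) ⟨x, μ⟩‖ ≤ _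
        rw [covDeriv_add', covDeriv_add', map_add, esub]
        exact norm_add_le _ _)
      ({x, x'} : Finset (HiggsLattice.Site P 0))
      (fun i hi g' => by
        have hx1 : ¬ Near K K₀ (rS P K K₀) i x := hi x (by simp)
        have hx2 : ¬ Near K K₀ (rS P K K₀) i x' := hi x' (by simp)
        show ‖hol C A x l (covDeriv C A (aOp C K K₀ Ω A msq a i g') ⟨x', μ⟩) - covDeriv C A (aOp C K K₀ Ω A msq a i g') ⟨x, μ⟩‖ ≤ 0
        rw [aOp_apply, covDeriv_hsmul_eq_zero_off C hK hK₀M hK₀8 i A _ (b := ⟨x', μ⟩) hx2,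
          covDeriv_hsmul_eq_zero_off C hK hK₀M hK₀8 i A _ (b := ⟨x, μ⟩) hx1, map_zero, sub_zero, norm_zero])
      (fun i g' hg' => hholK P hdd hPL1 hK1 hK hK₀M hN3 hcap S A hec hle4 hreg μ x x' l hxΩ hsΩ hx'Ω hs'Ω hne hch hend hlc hlen hnt
        i g' hg')
      (fun j ψ hψ => (hletters j ψ hψ).2.2)
      g (Dist := ⌈D⌉₊) hfX hrem
    -- the exponent `(⌈D⌉ − 4rS)/(2M) ≥ D/(2K₀L^K) − 3/2`
    have hh : (half P K K₀ : ℝ) = (P.L : ℝ) ^ K * K₀ := by unfold half; push_cast; ring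
    have hhpos : (0 : ℝ) < half P K K₀ := by exact_mod_cast half_pos hK₀'
    have hrS := rS_le_real (P := P) (K := K) hK₀8
    have hexp : Real.exp (-(((⌈D⌉₊ : ℝ) - 4 * rS P K K₀) / (2 * half P K K₀)))
        ≤ Real.exp (3 / 2) * Real.exp (-(D / (2 * K₀ * (P.L : ℝ) ^ K))) := by
      rw [← Real.exp_add]
      refine Real.exp_le_exp.2 ?_
      have hDc : D ≤ (⌈D⌉₊ : ℝ) := Nat.le_ceil D
      have e1 : D / (2 * K₀ * (P.L : ℝ) ^ K) = D / (2 * half P K K₀) := by rw [hh]; ring_nf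
      rw [e1]
      have h4 : (4 * (rS P K K₀ : ℝ)) ≤ 3 * half P K K₀ := by linarith
      have h5 : -(3 / 2 : ℝ) ≤ ((⌈D⌉₊ : ℝ) - D - 4 * rS P K K₀) / (2 * half P K K₀) := by
        rw [le_div_iff₀ (by positivity)]
        linarith
      have e2 : ((⌈D⌉₊ : ℝ) - 4 * rS P K K₀) / (2 * half P K K₀) - D / (2 * half P K K₀)
          = ((⌈D⌉₊ : ℝ) - D - 4 * rS P K K₀) / (2 * half P K K₀) := by ring
      linarith
    have hcard : (({x, x'} : Finset (HiggsLattice.Site P 0)).card : ℝ) ≤ 2 := by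
      exact_mod_cast (Finset.card_insert_le _ _).trans (by rw [Finset.card_singleton])
    have hw : ((t / (P.L : ℝ) ^ K)⁻¹) ^ α * (t / (P.L : ℝ) ^ K) ^ α = 1 := by
      rw [Real.inv_rpow hq0.le, inv_mul_cancel₀ (Real.rpow_pos_of_pos hq0 α).ne']
    have hQ : Q ≤ 4 * 2 ^ P.d * (CT * (t / (P.L : ℝ) ^ K) ^ α * P.mesh K) * (Real.exp (3 / 2)
        * Real.exp (-(D / (2 * K₀ * (P.L : ℝ) ^ K)))) * M := by
      refine hmain.trans ?_
      calc 2 * ((({x, x'} : Finset (HiggsLattice.Site P 0)).card : ℝ) * 2 ^ P.d) * (CT * (t / (P.L : ℝ) ^ K) ^ α * P.mesh K)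
            * Real.exp (-(((⌈D⌉₊ : ℝ) - 4 * rS P K K₀) / (2 * half P K K₀))) * ‖g‖
          ≤ 2 * (2 * 2 ^ P.d) * (CT * (t / (P.L : ℝ) ^ K) ^ α * P.mesh K)
            * (Real.exp (3 / 2) * Real.exp (-(D / (2 * K₀ * (P.L : ℝ) ^ K)))) * M := by
            refine mul_le_mul (mul_le_mul ?_ hexp (by positivity) (by positivity)) hgn (norm_nonneg _) (by positivity)
            have h1 : (({x, x'} : Finset (HiggsLattice.Site P 0)).card : ℝ) * 2 ^ P.d ≤ 2 * 2 ^ P.d :=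
              mul_le_mul_of_nonneg_right hcard (by positivity)
            have h2 : 2 * ((({x, x'} : Finset (HiggsLattice.Site P 0)).card : ℝ) * 2 ^ P.d) ≤ 2 * (2 * 2 ^ P.d) :=
              mul_le_mul_of_nonneg_left h1 (by norm_num)
            exact mul_le_mul_of_nonneg_right h2 (by positivity)
        _ = _ := by ring
    calc ((t / (P.L : ℝ) ^ K)⁻¹) ^ α * Q
        ≤ ((t / (P.L : ℝ) ^ K)⁻¹) ^ α * (4 * 2 ^ P.d * (CT * (t / (P.L : ℝ) ^ K) ^ α * P.mesh K) * (Real.exp (3 / 2)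
            * Real.exp (-(D / (2 * K₀ * (P.L : ℝ) ^ K)))) * M) :=
          mul_le_mul_of_nonneg_left hQ (Real.rpow_nonneg (inv_nonneg.2 hq0.le) α)
      _ = (((t / (P.L : ℝ) ^ K)⁻¹) ^ α * (t / (P.L : ℝ) ^ K) ^ α) * (4 * 2 ^ P.d * CT * Real.exp (3 / 2) * P.mesh K
            * Real.exp (-(D / (2 * K₀ * (P.L : ℝ) ^ K))) * M) := by ring
      _ = 4 * 2 ^ P.d * CT * Real.exp (3 / 2) * P.mesh K * Real.exp (-(D / (2 * K₀ * (P.L : ℝ) ^ K))) * M := by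
          rw [hw, one_mul]
      _ ≤ (4 * 2 ^ P.d * CT * Real.exp (3 / 2) + 2 * c₉) * P.mesh K * Real.exp (-(D / (2 * K₀ * (P.L : ℝ) ^ K))) * M := by
          have hle1 : 4 * 2 ^ P.d * CT * Real.exp (3 / 2) ≤ 4 * 2 ^ P.d * CT * Real.exp (3 / 2) + 2 * c₉ := by linarith
          exact mul_le_mul_of_nonneg_right (mul_le_mul_of_nonneg_right (mul_le_mul_of_nonneg_right hle1 hmesh.le) hE0) hM0
  · -- the regime `|x − x′| > L^K`: «a simple consequence of the corresponding inequality for the derivative only» — the derivative member at both bonds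
    have htn : (P.L : ℝ) ^ K < t := by
      rw [ht_def]; exact_mod_cast (not_le.1 hnt)
    have hw1 : ((t / (P.L : ℝ) ^ K)⁻¹) ^ α ≤ 1 :=
      Real.rpow_le_one (inv_nonneg.2 hq0.le) (inv_le_one_of_one_le₀ ((one_le_div hn0).2 htn.le)) hα0
    have h1 := hfar' x' hx'Ω hs'Ω hDx'
    have h2 := hfar' x hxΩ hsΩ hDx
    have hQ : Q ≤ 2 * c₉ * P.mesh K * Real.exp (-(D / (2 * K₀ * (P.L : ℝ) ^ K))) * M := by
      refine (norm_sub_le _ _).trans ?_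
      rw [norm_hol_apply]
      linarith
    calc ((t / (P.L : ℝ) ^ K)⁻¹) ^ α * Q ≤ 1 * Q := mul_le_mul_of_nonneg_right hw1 hQ0
      _ ≤ 2 * c₉ * P.mesh K * Real.exp (-(D / (2 * K₀ * (P.L : ℝ) ^ K))) * M := by rw [one_mul]; exact hQ
      _ ≤ (4 * 2 ^ P.d * CT * Real.exp (3 / 2) + 2 * c₉) * P.mesh K * Real.exp (-(D / (2 * K₀ * (P.L : ℝ) ^ K))) * M := by
          have hle2 : 2 * c₉ ≤ 4 * 2 ^ P.d * CT * Real.exp (3 / 2) + 2 * c₉ := by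
            have : 0 ≤ 4 * 2 ^ P.d * CT * Real.exp (3 / 2) := by positivity
            linarith
          exact mul_le_mul_of_nonneg_right (mul_le_mul_of_nonneg_right (mul_le_mul_of_nonneg_right hle2 hmesh.le) hE0) hM0

end Main

/-! ## §2 Summation over the `K`-blocks: arbitrary `g` -/

section Sum

variable {K : ℕ}

set_option maxHeartbeats 1600000 in
/-- **PROP. 2.1 (2.24) FOR BOXES OF LARGE BLOCKS WITHOUT `R₀` AT EVERY (2.23)-REGULAR FIELD, ARBITRARY `g`** — B4's THEOREM (1.9) ON THE CARRIER
FOR PARALLELEPIPEDS in the operator form of gens 10–15: same data as `norm_holder_propagatorK_box_reg_decay`; `K₀min` before `α`, then for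
every `0 ≤ α < 1` and `K₀ ≥ K₀min` constants `c₀(K₀), e₁(K₀) > 0` such that … for EVERY `g` with `‖g‖_∞ ≤ M′` vanishing within `D` of `x` and
of `x′`: `(|x − x′|/L^K)^{−α}·‖U(A(Γ))(D^ε_AG^ε_K(Ω,A)1_Ωg)(⟨x′,μ⟩) − (D^ε_AG^ε_K(Ω,A)1_Ωg)(⟨x,μ⟩)‖ ≤ c₀(K₀)(L^Kε)·exp(−D/(4K₀L^K))·M′`.
Proof: `g = Σ_b g|_{B^K(b)}` over the sites of `T^{(K)}`, the Hölder probe is subadditive, each piece is within §1 with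
`D_b = max(D, L^K(min(|x_K − b|, |x′_K − b|) − 1))`, and `Σ_b (e^{−|x_K − b|/(4K₀)} + e^{−|x′_K − b|/(4K₀)}) ≤ 2K_d(1/(4K₀))` (gen 12's summation,
verbatim).
[cite: Balaban1982Higgs1, Prop. 2.1 (2.23)–(2.24) p.610, p.611 l.1–2] [cite: Balaban1983RegularityDecay, Theorem (1.9) p.573; (2.21)–(2.22) pp.578–579; p.575 «taking the decomposition f = Σ_{Δ⊂Ω} Δf and summing the inequalities»] -/
theorem norm_holder_propagatorK_box_reg_decay_sum (d L : ℕ) (hd : 1 ≤ d) (hL : 2 ≤ L) {a : ℝ} (ha : 0 < a) {msq : ℝ}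
    (hmsq : 0 < msq) (N : ℕ) (C : ChargeData N) (ε₀ : ℝ) (creg β : ℝ) (hcreg : 0 ≤ creg) (hβ : 0 < β) :
    ∃ K₀min : ℕ, ∀ {α : ℝ}, 0 ≤ α → α < 1 → ∀ K₀ : ℕ, K₀min ≤ K₀ → ∃ c₀ e₁ : ℝ, 0 < c₀ ∧ 0 < e₁ ∧
      ∀ (P : HiggsLattice.Params), P.d = d → P.L = L → K₀ ∣ P.M →
      ∀ {K : ℕ}, 1 ≤ K → K ≤ P.K → (∀ μ, 3 * half P K K₀ ≤ P.sitesPerDir 0 μ) → P.mesh K ≤ ε₀ →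
      ∀ (S : Fin P.d → Finset ℕ) (A : HiggsLattice.VecField P 0) {ec : ℝ}, 0 < ec → ec ≤ e₁ →
      (∀ z ∈ cellBox K K₀ S, ∀ μ ν : Fin P.d,
          P.mesh K * |C.e| / ec * |A ⟨z.shift μ, ν⟩ - A ⟨z, ν⟩| ≤ creg * ec ^ (β - 1) / (P.L : ℝ) ^ K) →
      ∀ (μ : Fin P.d) (x x' : HiggsLattice.Site P 0), x' ≠ x →
        x ∈ cellBox K K₀ S → x.shift μ ∈ cellBox K K₀ S → x' ∈ cellBox K K₀ S → x'.shift μ ∈ cellBox K K₀ S →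
        ∀ (l : List (HiggsLattice.Site P 0)), IsTChain x l → pathEnd x l = x' → (∀ y ∈ l, y ∈ cellBox K K₀ S) →
          (l.length : ℝ) ≤ (P.d : ℝ) * HiggsLattice.Site.tdist x x' →
        ∀ (g : HiggsLattice.ScalarField P 0 N) (M D : ℝ), (∀ y, ‖g y‖ ≤ M) → 0 ≤ D →
          (∀ z, g z ≠ 0 → D ≤ (HiggsLattice.Site.tdist x z : ℝ)) → (∀ z, g z ≠ 0 → D ≤ (HiggsLattice.Site.tdist x' z : ℝ)) →
            (((HiggsLattice.Site.tdist x x' : ℝ) / (P.L : ℝ) ^ K)⁻¹) ^ α *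
                ‖hol C A x l (covDeriv C A (propagatorK C (cellBox K K₀ S) A msq a K (chi (cellBox K K₀ S) • g)) ⟨x', μ⟩)
                  - covDeriv C A (propagatorK C (cellBox K K₀ S) A msq a K (chi (cellBox K K₀ S) • g)) ⟨x, μ⟩‖
              ≤ c₀ * P.mesh K * Real.exp (-(D / (4 * K₀ * (P.L : ℝ) ^ K))) * M := by
  obtain ⟨K₀min, hmain⟩ := norm_holder_propagatorK_box_reg_decay d L hd hL ha hmsq N C ε₀ creg β hcreg hβ
  refine ⟨max K₀min 1, fun {α} hα0 hα1 K₀ hK₀ => ?_⟩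
  obtain ⟨c₀, hc₀, hmainα⟩ := hmain hα0 hα1
  have hK₀1 : 1 ≤ K₀ := le_trans (le_max_right _ _) hK₀
  have hK₀r : (0 : ℝ) < K₀ := by exact_mod_cast hK₀1
  obtain ⟨e₁, he₁, hblk⟩ := hmainα K₀ (le_trans (le_max_left _ _) hK₀)
  have hrate : (0 : ℝ) < 1 / (4 * K₀) := by positivity
  have hlc : 0 < latticeConst d (1 / (4 * K₀)) := by
    unfold latticeConst
    apply pow_pos
    have hdr : (0 : ℝ) < d := by exact_mod_cast hd
    have h1 : Real.exp (-(1 / (4 * (K₀ : ℝ)) / d)) < 1 := Real.exp_lt_one_iff.2 (by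
      have := div_pos hrate hdr; linarith)
    have h2 : 0 < 1 - Real.exp (-(1 / (4 * (K₀ : ℝ)) / d)) := by linarith
    positivity
  refine ⟨c₀ * Real.exp (1 / (4 * K₀)) * (2 * latticeConst d (1 / (4 * K₀))), e₁, by positivity, he₁, ?_⟩
  intro P hPd hPL hK₀M K hK1 hK hN3 hε S A ec hec hle hreg μ x x' hne hxΩ hsΩ hx'Ω hs'Ω l hch hend hlc' hlen g M D hgM hD0 hDx hDx'
  subst hPd
  set Ω : Finset (HiggsLattice.Site P 0) := cellBox K K₀ S with hΩdef
  have hmK0 : 0 < P.mesh K := P.mesh_pos K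
  have hM0 : 0 ≤ M := (norm_nonneg _).trans (hgM x)
  have hLK : (0 : ℝ) < (P.L : ℝ) ^ K := pow_pos (by exact_mod_cast P.hL) K
  set w : ℝ := (((HiggsLattice.Site.tdist x x' : ℝ) / (P.L : ℝ) ^ K)⁻¹) ^ α with hw_def
  have hw0 : 0 ≤ w := Real.rpow_nonneg (inv_nonneg.2 (div_nonneg (Nat.cast_nonneg _) hLK.le)) α
  -- split `g` over the `K`-blocks; the probe is subadditive
  have esub : ∀ (s : Finset (HiggsLattice.Site P K)) (u : HiggsLattice.Site P K → HiggsLattice.ScalarField P 0 N),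
      ‖hol C A x l (covDeriv C A (∑ b ∈ s, u b) ⟨x', μ⟩) - covDeriv C A (∑ b ∈ s, u b) ⟨x, μ⟩‖
        ≤ ∑ b ∈ s, ‖hol C A x l (covDeriv C A (u b) ⟨x', μ⟩) - covDeriv C A (u b) ⟨x, μ⟩‖ := by
    intro s u
    rw [covDeriv_sum', covDeriv_sum', map_sum, ← Finset.sum_sub_distrib]
    exact norm_sum_le _ _
  have hsplit : ‖hol C A x l (covDeriv C A (propagatorK C Ω A msq a K (chi Ω • g)) ⟨x', μ⟩)
        - covDeriv C A (propagatorK C Ω A msq a K (chi Ω • g)) ⟨x, μ⟩‖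
      ≤ ∑ b : HiggsLattice.Site P K, ‖hol C A x l (covDeriv C A (propagatorK C Ω A msq a K (chi Ω • blockPiece K b g)) ⟨x', μ⟩)
        - covDeriv C A (propagatorK C Ω A msq a K (chi Ω • blockPiece K b g)) ⟨x, μ⟩‖ := by
    have e : propagatorK C Ω A msq a K (chi Ω • g)
        = ∑ b : HiggsLattice.Site P K, propagatorK C Ω A msq a K (chi Ω • blockPiece K b g) := by
      conv_lhs => rw [← sum_blockPiece (K := K) g]
      rw [Finset.smul_sum, map_sum]
    rw [e]
    exact esub _ _
  -- each block piece: §1 with `D_b = max D (L^K(min(|x_K − b|, |x′_K − b|) − 1))`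
  have hpiece : ∀ b : HiggsLattice.Site P K,
      w * ‖hol C A x l (covDeriv C A (propagatorK C Ω A msq a K (chi Ω • blockPiece K b g)) ⟨x', μ⟩)
        - covDeriv C A (propagatorK C Ω A msq a K (chi Ω • blockPiece K b g)) ⟨x, μ⟩‖
        ≤ c₀ * P.mesh K * (Real.exp (-(D / (4 * K₀ * (P.L : ℝ) ^ K))) * Real.exp (1 / (4 * K₀))
            * (Real.exp (-(1 / (4 * K₀) * (HiggsLattice.Site.tdist (blockIter K x) b : ℝ)))
              + Real.exp (-(1 / (4 * K₀) * (HiggsLattice.Site.tdist (blockIter K x') b : ℝ))))) * M := by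
    intro b
    classical
    by_cases hb : ∃ y₀, blockIter K y₀ = b
    · obtain ⟨y₀, hy₀⟩ := hb
      set tm : ℝ := min (HiggsLattice.Site.tdist (blockIter K x) b : ℝ) (HiggsLattice.Site.tdist (blockIter K x') b : ℝ) with htm
      set Db : ℝ := max D ((P.L : ℝ) ^ K * (tm - 1)) with hDb
      have hDb0 : 0 ≤ Db := hD0.trans (le_max_left _ _)
      have hfarz : ∀ z₀ : HiggsLattice.Site P 0, tm ≤ (HiggsLattice.Site.tdist (blockIter K z₀) b : ℝ) →
          (∀ z, g z ≠ 0 → D ≤ (HiggsLattice.Site.tdist z₀ z : ℝ)) →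
          ∀ z, blockPiece K b g z ≠ 0 → Db ≤ (HiggsLattice.Site.tdist z₀ z : ℝ) := by
        intro z₀ htm' hDz z hz
        have hzb : blockIter K z = b := by
          by_contra h
          exact hz (by unfold blockPiece; rw [if_neg h])
        have hgz : g z ≠ 0 := fun h0 => hz (by unfold blockPiece; rw [if_pos hzb, h0])
        refine max_le (hDz z hgz) ?_
        have h1 := tdist_blockIter_le_real hK z₀ z
        rw [hzb] at h1
        have h2 : (P.L : ℝ) ^ K * (HiggsLattice.Site.tdist (blockIter K z₀) b : ℝ)
            ≤ (P.L : ℝ) ^ K * ((HiggsLattice.Site.tdist z₀ z : ℝ) / (P.L : ℝ) ^ K + 1 - ((P.L : ℝ) ^ K)⁻¹) :=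
          mul_le_mul_of_nonneg_left h1 hLK.le
        have e : (P.L : ℝ) ^ K * ((HiggsLattice.Site.tdist z₀ z : ℝ) / (P.L : ℝ) ^ K + 1 - ((P.L : ℝ) ^ K)⁻¹)
            = (HiggsLattice.Site.tdist z₀ z : ℝ) + (P.L : ℝ) ^ K - 1 := by field_simp
        rw [e] at h2
        have h3 : (P.L : ℝ) ^ K * (tm - 1) ≤ (P.L : ℝ) ^ K * ((HiggsLattice.Site.tdist (blockIter K z₀) b : ℝ) - 1) :=
          mul_le_mul_of_nonneg_left (by linarith) hLK.le
        rw [mul_sub, mul_one] at h3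
        linarith
      have h := hblk P rfl hPL hK₀M hK1 hK hN3 hε S A hec hle hreg μ x x' hne hxΩ hsΩ hx'Ω hs'Ω l hch hend hlc' hlen y₀ (blockPiece K b g)
        M Db (blockPiece_supported b g hy₀) (fun y => (norm_blockPiece_apply_le b g y).trans (hgM y)) hDb0
        (hfarz x (min_le_left _ _) hDx) (hfarz x' (min_le_right _ _) hDx')
      refine h.trans (mul_le_mul_of_nonneg_right (mul_le_mul_of_nonneg_left ?_ (by positivity)) hM0)
      -- `e^{−D_b/(2K₀L^K)} ≤ e^{−D/(4K₀L^K)}·e^{1/(4K₀)}·(e^{−|x_K − b|/(4K₀)} + e^{−|x′_K − b|/(4K₀)})`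
      have hK4 : (0 : ℝ) < 4 * K₀ * (P.L : ℝ) ^ K := by positivity
      have hmax : D + (P.L : ℝ) ^ K * (tm - 1) ≤ 2 * Db := by rw [two_mul]; exact add_le_add (le_max_left _ _) (le_max_right _ _)
      have key : (D + (P.L : ℝ) ^ K * (tm - 1)) / (4 * K₀ * (P.L : ℝ) ^ K) ≤ Db / (2 * K₀ * (P.L : ℝ) ^ K) :=
        calc (D + (P.L : ℝ) ^ K * (tm - 1)) / (4 * K₀ * (P.L : ℝ) ^ K)
            ≤ 2 * Db / (4 * K₀ * (P.L : ℝ) ^ K) := div_le_div_of_nonneg_right hmax hK4.le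
          _ = Db / (2 * K₀ * (P.L : ℝ) ^ K) := by field_simp; ring
      have e1 : (D + (P.L : ℝ) ^ K * (tm - 1)) / (4 * K₀ * (P.L : ℝ) ^ K)
          = D / (4 * K₀ * (P.L : ℝ) ^ K) - 1 / (4 * K₀) + 1 / (4 * K₀) * tm := by
        field_simp
        ring
      rw [e1] at key
      have hstep : Real.exp (-(Db / (2 * K₀ * (P.L : ℝ) ^ K)))
          ≤ Real.exp (-(D / (4 * K₀ * (P.L : ℝ) ^ K))) * Real.exp (1 / (4 * K₀)) * Real.exp (-(1 / (4 * K₀) * tm)) := by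
        rw [← Real.exp_add, ← Real.exp_add]
        exact Real.exp_le_exp.2 (by linarith)
      refine hstep.trans (mul_le_mul_of_nonneg_left ?_ (by positivity))
      rcases min_choice (HiggsLattice.Site.tdist (blockIter K x) b : ℝ) (HiggsLattice.Site.tdist (blockIter K x') b : ℝ) with h | h
      · rw [htm, h]; exact le_add_of_nonneg_right (Real.exp_pos _).le
      · rw [htm, h]; exact le_add_of_nonneg_left (Real.exp_pos _).le
    · -- no site maps to `b`: the piece vanishes
      have h0 : blockPiece K b g = 0 := by
        funext y
        unfold blockPiece
        rw [if_neg (fun h => hb ⟨y, h⟩)]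
        rfl
      rw [h0, smul_zero, map_zero, covDeriv_zero', covDeriv_zero', map_zero, sub_zero, norm_zero, mul_zero]
      positivity
  have hsumx := sum_exp_neg_tdist_le (P := P) (k := K) hrate (blockIter K x)
  have hsumx' := sum_exp_neg_tdist_le (P := P) (k := K) hrate (blockIter K x')
  calc w * ‖hol C A x l (covDeriv C A (propagatorK C Ω A msq a K (chi Ω • g)) ⟨x', μ⟩)
        - covDeriv C A (propagatorK C Ω A msq a K (chi Ω • g)) ⟨x, μ⟩‖
      ≤ w * ∑ b : HiggsLattice.Site P K, ‖hol C A x l (covDeriv C A (propagatorK C Ω A msq a K (chi Ω • blockPiece K b g)) ⟨x', μ⟩)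
        - covDeriv C A (propagatorK C Ω A msq a K (chi Ω • blockPiece K b g)) ⟨x, μ⟩‖ := mul_le_mul_of_nonneg_left hsplit hw0
    _ = ∑ b : HiggsLattice.Site P K, w * ‖hol C A x l (covDeriv C A (propagatorK C Ω A msq a K (chi Ω • blockPiece K b g)) ⟨x', μ⟩)
        - covDeriv C A (propagatorK C Ω A msq a K (chi Ω • blockPiece K b g)) ⟨x, μ⟩‖ := by rw [Finset.mul_sum]
    _ ≤ ∑ b : HiggsLattice.Site P K, c₀ * P.mesh K * (Real.exp (-(D / (4 * K₀ * (P.L : ℝ) ^ K))) * Real.exp (1 / (4 * K₀))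
            * (Real.exp (-(1 / (4 * K₀) * (HiggsLattice.Site.tdist (blockIter K x) b : ℝ)))
              + Real.exp (-(1 / (4 * K₀) * (HiggsLattice.Site.tdist (blockIter K x') b : ℝ))))) * M :=
        Finset.sum_le_sum fun b _ => hpiece b
    _ = c₀ * P.mesh K * (Real.exp (-(D / (4 * K₀ * (P.L : ℝ) ^ K))) * Real.exp (1 / (4 * K₀))
            * (∑ b : HiggsLattice.Site P K, Real.exp (-(1 / (4 * K₀) * (HiggsLattice.Site.tdist (blockIter K x) b : ℝ)))
              + ∑ b : HiggsLattice.Site P K, Real.exp (-(1 / (4 * K₀) * (HiggsLattice.Site.tdist (blockIter K x') b : ℝ))))) * M := by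
        rw [← Finset.sum_mul, ← Finset.mul_sum, ← Finset.mul_sum, Finset.sum_add_distrib]
    _ ≤ c₀ * P.mesh K * (Real.exp (-(D / (4 * K₀ * (P.L : ℝ) ^ K))) * Real.exp (1 / (4 * K₀))
            * (2 * latticeConst P.d (1 / (4 * K₀)))) * M :=
        mul_le_mul_of_nonneg_right (mul_le_mul_of_nonneg_left (mul_le_mul_of_nonneg_left (by linarith) (by positivity))
          (by positivity)) hM0
    _ = c₀ * Real.exp (1 / (4 * K₀)) * (2 * latticeConst P.d (1 / (4 * K₀))) * P.mesh K
            * Real.exp (-(D / (4 * K₀ * (P.L : ℝ) ^ K))) * M := by ring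

end Sum

end Literature.MathematicalPhysics.QuantumFieldTheory.Balaban1983to89.B1Ineq224RegularBox

end
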